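import Literature.NumberTheory.Automorphic.CongruenceSubgroupPropertySL2Lemma1
import Mathlib.LinearAlgebra.Projectivization.PSL.PSL2
import Mathlib.RingTheory.Localization.Integer
import HarnessLib

/-!
# Serre's congruence subgroup property for `SL₂(𝓞_F)` — proofs, IX: `SL₂` over the fraction field

Topic `Literature/NumberTheory/Automorphic`; namespace `Literature.NumberTheory.Automorphic.SL2Rel`.
Everything here is PROVED; one auxiliary definition (`SL2Rel.diagConj r`, conjugation of `SL₂` by
`diag(r, 1)` as a group automorphism — the only way `GL₂(k)` enters Vaserstein's paper).

The proofs of **Vaserstein 1972, Lemmas 2 and 4** take place in `SL₂(k)`, `k` the field of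
fractions of the ring of integers `A` (`SL₂(A) ⊂ SL₂(k)` through `Matrix.SpecialLinearGroup.map`):

* `SL2Rel.map_e12`, `map_e21`, `map_injective` — bookkeeping for `SL₂(A) → SL₂(k)`;
* `SL2Rel.diagConj r` — conjugation by `diag(r, 1)`, `r` a unit: `(a b; c d) ↦ (a, rb; r⁻¹c, d)`,
  with `diagConj r (E₁₂(x)) = E₁₂(rx)`, `diagConj r (E₂₁(y)) = E₂₁(r⁻¹y)` (Vaserstein, Lemma 4,
  Case 1: "матрица `g` диагональна"; general case: "`GL(2, k)` порождается диагональными матрицами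
  вместе с `(1 1; 0 1)`, `(1 0; 1 1)`");
* `SL2Rel.normal_le_center_or_eq_top` — **"всякий нормальный делитель в `GL(2, k)` либо содержится в
  центре, либо содержит `SL(2, k)`"** (proof of Lemma 2), here for `SL₂` over a field with an
  element `a ≠ 0`, `a² ≠ 1`, from Mathlib's simplicity of `PSL₂` (Iwasawa) and perfectness of `SL₂`;
* `SL2Rel.exists_conj_Gamma` — conjugating a deep principal congruence subgroup `Γ(D²J) ⊂ SL₂(A)` by
  any `h ∈ SL₂(k)` with denominators dividing `D` lands in `Γ(J)` (used to see that the set of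
  `g ∈ SL₂(k)` satisfying Lemma 2 is conjugation invariant).

## References

* [Vaserstein1972SL2] L. N. Vaserstein, Mat. Sb. 89 (131) (1972) 313–322, proofs of Lemmas 2 and 4.
* [Liehl1981SL2Orders] B. Liehl, J. reine angew. Math. 323 (1981) 153–171, §2 (4).
-/

open Matrix MatrixGroups

namespace Literature.NumberTheory.Automorphic

namespace SL2Rel

/-! ### `SL₂(R) → SL₂(S)` -/

section Map

variable {R S : Type*} [CommRing R] [CommRing S] (f : R →+* S)

/-- Entries of the image of a matrix under `SL₂(f)`. [folklore] -/
theorem map_apply_two (M : SL(2, R)) (i j : Fin 2) :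
    (SpecialLinearGroup.map f M) i j = f (M i j) := rfl

/-- `SL₂(f)(E₁₂(x)) = E₁₂(f x)`. [folklore] -/
theorem map_e12 (x : R) : SpecialLinearGroup.map f (e12 x) = e12 (f x) := by
  ext i j
  fin_cases i <;> fin_cases j <;> simp [map_apply_two]

/-- `SL₂(f)(E₂₁(y)) = E₂₁(f y)`. [folklore] -/
theorem map_e21 (y : R) : SpecialLinearGroup.map f (e21 y) = e21 (f y) := by
  ext i j
  fin_cases i <;> fin_cases j <;> simp [map_apply_two]

/-- `SL₂(f)` is injective when `f` is. [folklore] -/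
theorem map_injective (hf : Function.Injective f) :
    Function.Injective (SpecialLinearGroup.map f : SL(2, R) →* SL(2, S)) := by
  intro M N h
  ext i j
  apply hf
  have := congrArg (fun P : SL(2, S) ↦ P i j) h
  simpa only [map_apply_two] using this

/-- The image of `E(I₁, I₂)` under `SL₂(f)` is generated by the images of its generators. [folklore] -/
theorem map_relE (I₁ I₂ : Ideal R) :
    (relE I₁ I₂).map (SpecialLinearGroup.map f) =
      Subgroup.closure ((fun x ↦ e12 (f x)) '' (I₁ : Set R) ∪ (fun y ↦ e21 (f y)) '' (I₂ : Set R)) := by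
  rw [relE, MonoidHom.map_closure, Set.image_union, ← Set.image_comp, ← Set.image_comp]
  congr 3
  · ext x; simp [map_e12]
  · ext y; simp [map_e21]

end Map

/-! ### Conjugation by `diag(r, 1)` -/

section DiagConj

variable {R : Type*} [CommRing R]

/-- The matrix `(a, rb; r⁻¹c, d)` for `(a b; c d) ∈ SL₂(R)` and a unit `r`. [folklore] -/
def diagConjFun (r : Rˣ) (M : SL(2, R)) : SL(2, R) :=
  ⟨!![M 0 0, r * M 0 1; ((r⁻¹ : Rˣ) : R) * M 1 0, M 1 1], by
    rw [Matrix.det_fin_two_of]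
    linear_combination -(M 0 1 * M 1 0) * r.mul_inv + det_two M⟩

/-- Entries of `diagConjFun r M`. [folklore] -/
theorem diagConjFun_apply (r : Rˣ) (M : SL(2, R)) :
    diagConjFun r M 0 0 = M 0 0 ∧ diagConjFun r M 0 1 = r * M 0 1 ∧
      diagConjFun r M 1 0 = ((r⁻¹ : Rˣ) : R) * M 1 0 ∧ diagConjFun r M 1 1 = M 1 1 :=
  ⟨rfl, rfl, rfl, rfl⟩

/-- `diagConjFun` is multiplicative (it is conjugation by `diag(r, 1)` in `GL₂`). [folklore] -/
theorem diagConjFun_mul (r : Rˣ) (M N : SL(2, R)) :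
    diagConjFun r (M * N) = diagConjFun r M * diagConjFun r N := by
  have hr : (r : R) * ((r⁻¹ : Rˣ) : R) = 1 := r.mul_inv
  ext i j
  fin_cases i <;> fin_cases j <;>
    simp only [diagConjFun, mul_apply_two, Fin.zero_eta, Fin.isValue, Fin.mk_one, of_apply, cons_val',
      cons_val_zero, cons_val_one, cons_val_fin_one, empty_val']
  · linear_combination -(M 0 1 * N 1 0) * hr
  · ring
  · ring
  · linear_combination -(M 1 0 * N 0 1) * hr

/-- `diagConjFun r⁻¹` is inverse to `diagConjFun r`. [folklore] -/
theorem diagConjFun_inv_apply (r : Rˣ) (M : SL(2, R)) : diagConjFun r⁻¹ (diagConjFun r M) = M := by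
  ext i j
  fin_cases i <;> fin_cases j <;>
    simp [diagConjFun, ← mul_assoc]

/-- **Conjugation by `diag(r, 1)`** (`r` a unit) as an automorphism of `SL₂(R)`:
`(a b; c d) ↦ (a, rb; r⁻¹c, d)`.  [cite: Vaserstein1972SL2, Lemma 4 (Case 1)] -/
def diagConj (r : Rˣ) : SL(2, R) ≃* SL(2, R) where
  toFun := diagConjFun r
  invFun := diagConjFun r⁻¹
  left_inv M := diagConjFun_inv_apply r M
  right_inv M := by simpa using diagConjFun_inv_apply r⁻¹ M
  map_mul' := diagConjFun_mul r

/-- Entries of `diagConj r M`. [folklore] -/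
theorem diagConj_apply (r : Rˣ) (M : SL(2, R)) :
    diagConj r M 0 0 = M 0 0 ∧ diagConj r M 0 1 = r * M 0 1 ∧
      diagConj r M 1 0 = ((r⁻¹ : Rˣ) : R) * M 1 0 ∧ diagConj r M 1 1 = M 1 1 :=
  ⟨rfl, rfl, rfl, rfl⟩

/-- `diag(r, 1) E₁₂(x) diag(r, 1)⁻¹ = E₁₂(rx)`. [folklore] -/
theorem diagConj_e12 (r : Rˣ) (x : R) : diagConj r (e12 x) = e12 (r * x) := by
  ext i j
  fin_cases i <;> fin_cases j <;> simp [diagConj, diagConjFun]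

/-- `diag(r, 1) E₂₁(y) diag(r, 1)⁻¹ = E₂₁(r⁻¹y)`. [folklore] -/
theorem diagConj_e21 (r : Rˣ) (y : R) : diagConj r (e21 y) = e21 (((r⁻¹ : Rˣ) : R) * y) := by
  ext i j
  fin_cases i <;> fin_cases j <;> simp [diagConj, diagConjFun]

/-- `(diagConj r)⁻¹ = diagConj r⁻¹`. [folklore] -/
theorem diagConj_symm (r : Rˣ) : (diagConj r).symm = diagConj (R := R) r⁻¹ := rfl

end DiagConj

/-! ### Normal subgroups of `SL₂` over a field -/

section Normal

variable {F : Type*} [Field F]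

/-- **A normal subgroup of `SL₂(F)` is central or everything**, for a field `F` with an element
`a ≠ 0`, `a² ≠ 1` (e.g. any field with more than `3` elements): `PSL₂(F)` is simple (Mathlib, via
Iwasawa's criterion) and `SL₂(F)` is perfect. [folklore] -/
theorem normal_le_center_or_eq_top (hF : ∃ a : F, a ≠ 0 ∧ a ^ 2 ≠ 1) (N : Subgroup SL(2, F))
    [hN : N.Normal] : N ≤ Subgroup.center SL(2, F) ∨ N = ⊤ := by
  haveI := Matrix.ProjectiveSpecialLinearGroup.rank_two_simple' hF
  set π : SL(2, F) →* PSL(2, F) := QuotientGroup.mk' (Subgroup.center SL(2, F)) with hπ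
  have hπker : π.ker = Subgroup.center SL(2, F) := QuotientGroup.ker_mk' _
  haveI : (N.map π).Normal := hN.map π (QuotientGroup.mk'_surjective _)
  rcases IsSimpleGroup.eq_bot_or_eq_top_of_normal (N.map π) inferInstance with h | h
  · left
    intro n hn
    rw [← hπker, MonoidHom.mem_ker, ← Subgroup.mem_bot, ← h]
    exact Subgroup.mem_map_of_mem π hn
  · right
    obtain ⟨a, ha, ha2⟩ := hF
    have hsup : N ⊔ Subgroup.center SL(2, F) = ⊤ := by
      rw [← hπker, ← Subgroup.comap_map_eq, h, Subgroup.comap_top]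
    rw [eq_top_iff, ← SL2.commutator_eq_top ha ha2, commutator_def, Subgroup.commutator_le]
    intro g₁ _ g₂ _
    have : g₁ ∈ ((N ⊔ Subgroup.center SL(2, F) : Subgroup SL(2, F)) : Set SL(2, F)) := by
      rw [hsup]; exact Set.mem_univ _
    rw [Subgroup.mul_normal] at this
    obtain ⟨n₁, hn₁, z₁, hz₁, rfl⟩ := this
    rw [SetLike.mem_coe, Subgroup.mem_center_iff] at hz₁
    rw [commutatorElement_def]
    have e : n₁ * z₁ * g₂ * (n₁ * z₁)⁻¹ * g₂⁻¹ = n₁ * (g₂ * n₁⁻¹ * g₂⁻¹) := by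
      calc n₁ * z₁ * g₂ * (n₁ * z₁)⁻¹ * g₂⁻¹ = n₁ * (z₁ * g₂) * z₁⁻¹ * n₁⁻¹ * g₂⁻¹ := by group
        _ = n₁ * (g₂ * z₁) * z₁⁻¹ * n₁⁻¹ * g₂⁻¹ := by rw [hz₁ g₂]
        _ = n₁ * (g₂ * n₁⁻¹ * g₂⁻¹) := by group
    rw [e]
    exact N.mul_mem hn₁ (hN.conj_mem _ (N.inv_mem hn₁) g₂)

end Normal

/-! ### Conjugating congruence subgroups inside `SL₂(k)` -/

section Fraction

variable {R : Type*} [CommRing R] [IsDomain R] {F : Type*} [Field F] [Algebra R F]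
  [IsFractionRing R F]

/-- **Conjugates of deep congruence subgroups are congruence-deep**: for `h ∈ SL₂(k)` and an ideal
`J ≠ 0` of `R` (`k = Frac R`) there is an ideal `0 ≠ J' ⊆ J` (namely `D²J`, `D` a common denominator
of the entries of `h`) such that `h Γ(J') h⁻¹ ⊆ Γ(J)` inside `SL₂(k)`. [folklore] -/
theorem exists_conj_Gamma (h : SL(2, F)) {J : Ideal R} (hJ : J ≠ ⊥) :
    ∃ J' : Ideal R, J' ≠ ⊥ ∧ J' ≤ J ∧ ∀ A ∈ Gamma J', ∃ B ∈ Gamma J,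
      SpecialLinearGroup.map (algebraMap R F) B = h * SpecialLinearGroup.map (algebraMap R F) A * h⁻¹ := by
  classical
  -- a common denominator `D` of the entries of `h` (and so of `h⁻¹ = adj h`)
  obtain ⟨D, hD⟩ := IsLocalization.exist_integer_multiples_of_finite (nonZeroDivisors R)
    (fun p : Fin 2 × Fin 2 ↦ h p.1 p.2)
  choose n hn using fun i j ↦ hD (i, j)
  -- `hn i j : algebraMap R F (n i j) = D • h i j`
  have hD0 : (D : R) ≠ 0 := nonZeroDivisors.coe_ne_zero D
  set d : R := (D : R) with hd
  have hn' : ∀ i j, algebraMap R F (n i j) = algebraMap R F d * h i j := fun i j ↦ by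
    rw [hn i j, hd, Algebra.smul_def]
  obtain ⟨i00, i01, i10, i11⟩ := inv_apply_two h
  -- numerators of `D h⁻¹`
  let m : Fin 2 → Fin 2 → R := ![![n 1 1, -n 0 1], ![-n 1 0, n 0 0]]
  have hm' : ∀ i j, algebraMap R F (m i j) = algebraMap R F d * (h⁻¹) i j := by
    intro i j
    fin_cases i <;> fin_cases j <;>
      simp only [m, Fin.zero_eta, Fin.isValue, Fin.mk_one, cons_val_zero, cons_val_one,
        cons_val_fin_one, map_neg, hn', i00, i01, i10, i11, mul_neg]
  refine ⟨Ideal.span {d * d} * J, ?_, Ideal.mul_le_left, fun A hA ↦ ?_⟩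
  · rw [Ne, ← Ideal.zero_eq_bot]
    refine mul_ne_zero ?_ (by rwa [Ideal.zero_eq_bot])
    rw [Ne, Ideal.zero_eq_bot, Ideal.span_singleton_eq_bot]
    exact mul_ne_zero hD0 hD0
  -- entries of `A - 1` are `d² y` with `y ∈ J`
  rw [mem_Gamma] at hA
  have key : ∀ {x : R}, x ∈ Ideal.span {d * d} * J → ∃ y ∈ J, x = d * d * y := fun hx ↦ by
    obtain ⟨y, hyJ, rfl⟩ := Ideal.mem_span_singleton_mul.1 hx
    exact ⟨y, hyJ, rfl⟩
  have hy : ∀ i j, ∃ y ∈ J, A i j = (1 : SL(2, R)) i j + d * d * y := by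
    intro i j
    fin_cases i <;> fin_cases j
    · obtain ⟨y, hyJ, e⟩ := key hA.2.2.1
      exact ⟨y, hyJ, by simp only [Fin.zero_eta, Fin.isValue, one_apply_00]; linear_combination e⟩
    · obtain ⟨y, hyJ, e⟩ := key hA.1
      exact ⟨y, hyJ, by simp only [Fin.zero_eta, Fin.isValue, Fin.mk_one, one_apply_01]; linear_combination e⟩
    · obtain ⟨y, hyJ, e⟩ := key hA.2.1
      exact ⟨y, hyJ, by simp only [Fin.zero_eta, Fin.isValue, Fin.mk_one, one_apply_10]; linear_combination e⟩
    · obtain ⟨y, hyJ, e⟩ := key hA.2.2.2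
      exact ⟨y, hyJ, by simp only [Fin.isValue, Fin.mk_one, one_apply_11]; linear_combination e⟩
  choose y hyJ hAy using hy
  -- the candidate `B = 1 + (d h) y (d h⁻¹)`
  let B₀ : Matrix (Fin 2) (Fin 2) R := fun i j ↦
    (1 : SL(2, R)) i j + ∑ k, ∑ l, n i k * y k l * m l j
  set ι := SpecialLinearGroup.map (n := Fin 2) (algebraMap R F) with hι
  have e1 : ∀ i j, algebraMap R F ((1 : SL(2, R)) i j) = (1 : SL(2, F)) i j := fun i j ↦ by
    fin_cases i <;> fin_cases j <;> simp
  have hAF : ∀ k l, (ι A) k l = (1 : SL(2, F)) k l +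
      algebraMap R F d * algebraMap R F d * algebraMap R F (y k l) := fun k l ↦ by
    rw [hι, map_apply_two, hAy k l, map_add, map_mul, map_mul, e1]
  have hentry : ∀ i j, algebraMap R F (B₀ i j) = (h * ι A * h⁻¹) i j := by
    intro i j
    have hhinv : h i 0 * (h⁻¹) 0 j + h i 1 * (h⁻¹) 1 j = (1 : SL(2, F)) i j := by
      rw [← mul_apply_two, mul_inv_cancel]
    have lhs : algebraMap R F (B₀ i j) = (1 : SL(2, F)) i j +
        ∑ k, ∑ l, (algebraMap R F d * h i k) * algebraMap R F (y k l) *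
          (algebraMap R F d * (h⁻¹) l j) := by
      simp only [B₀, map_add, map_sum, map_mul, hn', hm', e1]
    rw [lhs, ← hhinv, mul_apply_two, mul_apply_two h (ι A), mul_apply_two h (ι A)]
    simp only [hAF, Fin.sum_univ_two, one_apply_00, one_apply_01, one_apply_10, one_apply_11]
    ring
  have hmat : (algebraMap R F).mapMatrix B₀ = ((h * ι A * h⁻¹ : SL(2, F)) : Matrix (Fin 2) (Fin 2) F) := by
    ext i j
    exact hentry i j
  have hdet : B₀.det = 1 := by
    apply IsFractionRing.injective R F
    rw [RingHom.map_det, hmat, Matrix.SpecialLinearGroup.det_coe, map_one]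
  refine ⟨⟨B₀, hdet⟩, ?_, ?_⟩
  · have hsum : ∀ i j, ∑ k, ∑ l, n i k * y k l * m l j ∈ J := fun i j ↦
      J.sum_mem fun k _ ↦ J.sum_mem fun l _ ↦ J.mul_mem_right _ (J.mul_mem_left _ (hyJ k l))
    rw [mem_Gamma]
    refine ⟨?_, ?_, ?_, ?_⟩
    · change B₀ 0 1 ∈ J
      simp only [B₀, one_apply_01, zero_add]; exact hsum 0 1
    · change B₀ 1 0 ∈ J
      simp only [B₀, one_apply_10, zero_add]; exact hsum 1 0
    · change B₀ 0 0 - 1 ∈ J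
      simp only [B₀, one_apply_00, add_sub_cancel_left]; exact hsum 0 0
    · change B₀ 1 1 - 1 ∈ J
      simp only [B₀, one_apply_11, add_sub_cancel_left]; exact hsum 1 1
  · ext i j
    exact hentry i j

end Fraction

end SL2Rel

end Literature.NumberTheory.Automorphic
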